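import Literature.MathematicalPhysics.QuantumLattice.HubbardNNNHoppingFluxThermal
import HarnessLib

/-!
# Hubbard ladder — Bounds: the `e₁`-current operator of the `t–t'` torus and the one-parameter
# trial state `ψ + m Jψ` at flux `θ` (part 1 of 2 of the current-moment stiffness ceiling)

HONEST FRAMING (cell pub-hubbard): ladder R1–R4 with certified numbers; no claim on H/H₀. This is
a bound for a MODEL CLASS (the `t–t'` Hubbard torus `hubbardTorusTT' L 1 t' U` on `(ℤ/L)²`, every
`t'`, `U`, filling), no materials claim. Companion text: `pub-hubbard/paper/bounds.tex` Thm 5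
(SHARPENING #6, "current moments"); table `pub-hubbard/pub-hubbard-bounds/BOUNDS.md` row T1e.

FILE SPLIT (tree lint: files under `Summits/…` are ≤ 400 lines): part 1 = this file (the current
operator `curOpTT'`, its sector / Hermiticity / expectation lemmas, the sector Rayleigh bound for
non-unit vectors, and the TRIAL INEQUALITY `fluxEnergyTT'_trial_le`); part 2 =
`StiffnessCeilingCurrentMoments.lean` (the `θ → 0` extraction and the theorem
`CurrentMomentStiffnessCeilingTT'` with its corollaries).

## What is proved here (no `sorry`, no new axioms)

Let `H = hubbardTorusTT' L 1 t' U`, `E(θ) = fluxEnergyTT' L t' U δ θ` (the flux envelope of the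
sector `(N_L, S^z = 0)`), `K = kinOpTT' L t'` (`Re⟨χ, Kχ⟩ = 2(K_x + t' K_d)(χ)`) and
`J = curOpTT' L t'` (this file): `Re⟨χ, Jχ⟩ = 2(J_x + t' J_d)(χ)`, the bond CURRENTS that multiply
`2 sin(θ/L)` in the Rayleigh expansion of the uniformly twisted torus
(`re_star_dotProduct_uniformTwistTT'_mulVec`).

* `re_uniformTwistTT'_eq_kin_cur` — operator form of the uniform twist in a fixed vector:
  `Re⟨χ, H_θ χ⟩ = Re⟨χ, Hχ⟩ + (1 − cos(θ/L)) Re⟨χ, Kχ⟩ + sin(θ/L) Re⟨χ, Jχ⟩` (`L ≥ 3`).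
* `fluxEnergyTT'_mul_normSq_le` — `E(θ) ‖χ‖² ≤ Re⟨χ, H_θ χ⟩` for EVERY (not necessarily unit)
  sector vector `χ` (uniform gauge + `minEnergyOn_mul_re_le`).
* `TrialInequalityTT'` (`@[conjecture] def`, PROVED by `trialInequalityTT'_holds` from
  `fluxEnergyTT'_trial_le`) — the trial inequality for `χ = ψ + m Jψ`, `ψ` a unit zero-flux sector
  ground state, `m : ℝ`: `E(θ)‖χ‖² ≤ E(0)‖χ‖² + m² b + (1 − cos(θ/L)) Re⟨χ,Kχ⟩ + sin(θ/L) Re⟨χ,Jχ⟩`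
  with every quadratic form expanded along the line (`re_quadForm_add_smul`) and
  `b = Re⟨Jψ, H Jψ⟩ − E(0)‖Jψ‖²`.

References (keys of `lean/references.bib`): ScalapinoWhiteZhang1993 §II (current operator,
`Λ_xx`); HazraVermaRanderia2019 eqs. (2)–(4); Watanabe2019 §2.2.1–§2.2.3, §4.1 (uniform gauge).
-/

noncomputable section

namespace Summit.HubbardSuperconductivity.HubbardLadder.Bounds

open Matrix Finset Real
open Literature.MathematicalPhysics.QuantumLattice
open Literature.MathematicalPhysics.QuantumFieldTheory
open Literature.Probability.LatticeModels
open scoped ComplexConjugate ComplexOrder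

/-! ### Hermitian quadratic forms along a real line; the sector Rayleigh bound for non-unit vectors -/

section General

variable {n : Type*} [Fintype n]

/-- For a Hermitian matrix, `⟨φ, B ψ⟩ = conj ⟨ψ, B φ⟩`. [folklore] -/
theorem star_dotProduct_mulVec_symm {B : Matrix n n ℂ} (hB : B.IsHermitian) (ψ φ : n → ℂ) :
    star φ ⬝ᵥ (B *ᵥ ψ) = star (star ψ ⬝ᵥ (B *ᵥ φ)) := by
  conv_rhs => rw [← star_dotProduct_star, star_star, star_mulVec, ← dotProduct_mulVec, hB.eq]

/-- Real parts: `Re⟨φ, B ψ⟩ = Re⟨ψ, B φ⟩` for Hermitian `B`. [folklore] -/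
theorem re_star_dotProduct_mulVec_symm {B : Matrix n n ℂ} (hB : B.IsHermitian) (ψ φ : n → ℂ) :
    (star φ ⬝ᵥ (B *ᵥ ψ)).re = (star ψ ⬝ᵥ (B *ᵥ φ)).re := by
  rw [star_dotProduct_mulVec_symm hB, Complex.star_def, Complex.conj_re]

/-- The real quadratic form of a Hermitian `B` along the real line `ψ + m φ`:
`Re⟨ψ + mφ, B(ψ + mφ)⟩ = Re⟨ψ, Bψ⟩ + 2m Re⟨φ, Bψ⟩ + m² Re⟨φ, Bφ⟩`. [folklore] -/
theorem re_quadForm_add_smul {B : Matrix n n ℂ} (hB : B.IsHermitian) (ψ φ : n → ℂ) (m : ℝ) :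
    (star (ψ + (m : ℂ) • φ) ⬝ᵥ (B *ᵥ (ψ + (m : ℂ) • φ))).re =
      (star ψ ⬝ᵥ (B *ᵥ ψ)).re + 2 * m * (star φ ⬝ᵥ (B *ᵥ ψ)).re +
        m ^ 2 * (star φ ⬝ᵥ (B *ᵥ φ)).re := by
  have hsym : (star ψ ⬝ᵥ (B *ᵥ φ)).re = (star φ ⬝ᵥ (B *ᵥ ψ)).re :=
    re_star_dotProduct_mulVec_symm hB φ ψ
  simp only [mulVec_add, mulVec_smul, star_add, star_smul, add_dotProduct, dotProduct_add,
    smul_dotProduct, dotProduct_smul, smul_eq_mul, Complex.add_re, Complex.star_def,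
    Complex.conj_ofReal, Complex.re_ofReal_mul, hsym]
  ring

/-- The squared norm along the real line `ψ + m φ`:
`‖ψ + mφ‖² = ‖ψ‖² + 2m Re⟨φ, ψ⟩ + m² ‖φ‖²`. [folklore] -/
theorem re_normSq_add_smul (ψ φ : n → ℂ) (m : ℝ) :
    (star (ψ + (m : ℂ) • φ) ⬝ᵥ (ψ + (m : ℂ) • φ)).re =
      (star ψ ⬝ᵥ ψ).re + 2 * m * (star φ ⬝ᵥ ψ).re + m ^ 2 * (star φ ⬝ᵥ φ).re := by
  classical
  have h := re_quadForm_add_smul (Matrix.isHermitian_one : (1 : Matrix n n ℂ).IsHermitian) ψ φ m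
  simpa only [one_mulVec] using h

variable [DecidableEq n]

/-- **The sector Rayleigh bound for a non-unit vector**: `E_min(H|K) · ‖χ‖² ≤ Re⟨χ, H χ⟩` for every
`χ ∈ K` (normalise `χ ≠ 0` and use `minEnergyOn_le_rayleigh_of_mem`; trivial at `χ = 0`).
[folklore] -/
theorem minEnergyOn_mul_re_le {H : Matrix n n ℂ} (hH : H.IsHermitian) (K : Submodule ℂ (n → ℂ))
    {χ : n → ℂ} (hχ : χ ∈ K) :
    H.minEnergyOn K * (star χ ⬝ᵥ χ).re ≤ (star χ ⬝ᵥ (H *ᵥ χ)).re := by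
  by_cases h0 : χ = 0
  · subst h0
    simp
  have hpos : 0 < star χ ⬝ᵥ χ := Matrix.dotProduct_star_self_pos_iff.2 h0
  obtain ⟨hre, him⟩ := Complex.pos_iff.1 hpos
  set r : ℝ := (star χ ⬝ᵥ χ).re with hr
  have hχr : star χ ⬝ᵥ χ = (r : ℂ) :=
    Complex.ext (by rw [Complex.ofReal_re, hr]) (by rw [Complex.ofReal_im, ← him])
  have hcr : (Real.sqrt r)⁻¹ * (Real.sqrt r)⁻¹ * r = 1 := by
    rw [← mul_inv, Real.mul_self_sqrt hre.le, inv_mul_cancel₀ hre.ne']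
  have hunit : star ((((Real.sqrt r)⁻¹ : ℝ) : ℂ) • χ) ⬝ᵥ ((((Real.sqrt r)⁻¹ : ℝ) : ℂ) • χ) = 1 := by
    rw [star_smul, smul_dotProduct, dotProduct_smul, hχr, Complex.star_def, Complex.conj_ofReal,
      smul_eq_mul, smul_eq_mul, ← mul_assoc, ← Complex.ofReal_mul, ← Complex.ofReal_mul, hcr,
      Complex.ofReal_one]
  have hmem : ((((Real.sqrt r)⁻¹ : ℝ) : ℂ) • χ) ∈ K := K.smul_mem _ hχ
  have hray := minEnergyOn_le_rayleigh_of_mem hH K hmem hunit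
  have hexp : (star ((((Real.sqrt r)⁻¹ : ℝ) : ℂ) • χ) ⬝ᵥ
      (H *ᵥ ((((Real.sqrt r)⁻¹ : ℝ) : ℂ) • χ))).re =
      (Real.sqrt r)⁻¹ * (Real.sqrt r)⁻¹ * (star χ ⬝ᵥ (H *ᵥ χ)).re := by
    rw [mulVec_smul, star_smul, smul_dotProduct, dotProduct_smul, Complex.star_def,
      Complex.conj_ofReal, smul_eq_mul, smul_eq_mul, ← mul_assoc, ← Complex.ofReal_mul,
      Complex.re_ofReal_mul]
  rw [hexp] at hray
  have h2 := mul_le_mul_of_nonneg_right hray hre.le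
  calc H.minEnergyOn K * r
      ≤ (Real.sqrt r)⁻¹ * (Real.sqrt r)⁻¹ * (star χ ⬝ᵥ (H *ᵥ χ)).re * r := h2
    _ = (Real.sqrt r)⁻¹ * (Real.sqrt r)⁻¹ * r * (star χ ⬝ᵥ (H *ᵥ χ)).re := by ring
    _ = (star χ ⬝ᵥ (H *ᵥ χ)).re := by rw [hcr, one_mul]

end General

/-! ### Sector-preserving matrices map every joint sector into itself -/

section Sector

variable {Λ : Type*} [LinearOrder Λ] [Fintype Λ]

/-- A matrix conserving `N↑` and `N↓` (`PreservesSectors`) maps every joint sector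
`(N, S^z = M)` into itself. [folklore] -/
theorem mulVec_mem_szSector_of_preservesSectors {A : Matrix (Finset (Orb Λ)) (Finset (Orb Λ)) ℂ}
    (hA : PreservesSectors A) {N : ℕ} {M : ℝ} {ψ : Fock (Orb Λ)} (h : ψ ∈ szSector N M) :
    A *ᵥ ψ ∈ szSector N M := by
  rw [mem_szSector_iff] at h ⊢
  obtain ⟨hN, hZ⟩ := h
  refine ⟨fun s hs => ?_, ?_⟩
  · show ∑ s', A s s' * ψ s' = 0
    refine Finset.sum_eq_zero fun s' _ => ?_
    by_cases hA0 : A s s' = 0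
    · rw [hA0, zero_mul]
    · have hss := hA s s' hA0
      rw [hN s' ?_, mul_zero]
      rw [card_eq_upPart_add_downPart] at hs ⊢
      rwa [← hss.1, ← hss.2]
  · funext s
    have hmul : (A *ᵥ ψ) s = ∑ s', A s s' * ψ s' := rfl
    rw [LiebThm1.spinZ_mulVec_apply, Pi.smul_apply, smul_eq_mul, hmul, Finset.mul_sum,
      Finset.mul_sum]
    refine Finset.sum_congr rfl fun s' _ => ?_
    by_cases hA0 : A s s' = 0
    · rw [hA0, zero_mul, mul_zero, mul_zero]
    · have hss := hA s s' hA0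
      have hs' := congrFun hZ s'
      rw [LiebThm1.spinZ_mulVec_apply, Pi.smul_apply, smul_eq_mul] at hs'
      rw [hss.1, hss.2]
      linear_combination (A s s') * hs'

end Sector

/-! ### The `e₁`-current operator of the `t–t'` torus -/

variable {L : ℕ} [NeZero L]

variable (L) in
/-- The **`e₁`-current operator** of the `t–t'` torus:
`J = Σ_{x,σ} (−i c†_{x+e₁,σ} c_{x,σ} + i c†_{x,σ} c_{x+e₁,σ})
    + t' Σ_{s,x,σ} (−i c†_{x+j_s,σ} c_{x,σ} + h.c.)`
— every bond advancing `x₁` by one, weighted by its hopping amplitude (the paramagnetic current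
`j^P_x(q = 0)` of the `t–t'` band, `∂_θ H_θ` of the uniformly twisted torus at `θ = 0` up to the
factor `1/L`). [cite: ScalapinoWhiteZhang1993, §II] -/
def curOpTT' (t' : ℝ) :
    Matrix (Finset (Orb (FermionTorus 2 L))) (Finset (Orb (FermionTorus 2 L))) ℂ :=
  (∑ x : Site 2 L, ∑ σ : Fin 2,
      ((-Complex.I) • (creation (orb (FermionTorus.ofTorusSite (Site.shift x 0)) σ) *
          annihilation (orb (FermionTorus.ofTorusSite x) σ)) +
        Complex.I • (creation (orb (FermionTorus.ofTorusSite x) σ) *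
          annihilation (orb (FermionTorus.ofTorusSite (Site.shift x 0)) σ)))) +
    (t' : ℂ) • diagPeierlsHopping L (fun _ _ => -Complex.I)

/-- A diagonal Peierls bond sum conserves `N↑` and `N↓` (spin-diagonal hoppings). [folklore] -/
theorem preservesSectors_diagPeierlsHopping' (a : Fin 2 → Site 2 L → ℂ) :
    PreservesSectors (diagPeierlsHopping L a) := by
  unfold diagPeierlsHopping
  exact PreservesSectors.sum fun s _ => PreservesSectors.sum fun x _ =>
    PreservesSectors.sum fun σ _ =>
      ((LiebThm1.preservesSectors_hopping _ _ σ).smul _).add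
        ((LiebThm1.preservesSectors_hopping _ _ σ).smul _)

/-- The current operator conserves `N↑` and `N↓`. [folklore] -/
theorem preservesSectors_curOpTT' (t' : ℝ) : PreservesSectors (curOpTT' L t') := by
  unfold curOpTT'
  exact (PreservesSectors.sum fun x _ => PreservesSectors.sum fun σ _ =>
      ((LiebThm1.preservesSectors_hopping _ _ σ).smul _).add
        ((LiebThm1.preservesSectors_hopping _ _ σ).smul _)).add
    ((preservesSectors_diagPeierlsHopping' _).smul _)

/-- The current operator is Hermitian (`(−i X)ᴴ = i Xᴴ`). [folklore] -/
theorem isHermitian_curOpTT' (t' : ℝ) : (curOpTT' L t').IsHermitian := by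
  refine IsHermitian.add ?_ (isHermitian_ofReal_smul (isHermitian_diagPeierlsHopping L _) _)
  unfold Matrix.IsHermitian
  simp only [conjTranspose_sum]
  refine Finset.sum_congr rfl fun x _ => Finset.sum_congr rfl fun σ _ => ?_
  rw [conjTranspose_add, conjTranspose_smul, conjTranspose_smul,
    conjTranspose_creation_mul_annihilation, conjTranspose_creation_mul_annihilation, add_comm,
    star_neg, Complex.star_def, Complex.conj_I, neg_neg]

/-- `Re⟨φ, J φ⟩ = 2 (J_x(φ) + t' J_d(φ))` with `J_x(φ) = Σ_{x,σ} Im⟨φ, c†_{x+e₁,σ} c_{x,σ} φ⟩`,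
`J_d(φ) = Σ_{s,x,σ} Im⟨φ, c†_{x+j_s,σ} c_{x,σ} φ⟩` — the bond currents that multiply `2 sin(θ/L)`
in the Rayleigh expansion `re_star_dotProduct_uniformTwistTT'_mulVec`.
[cite: Watanabe2019, §2.2.1] -/
theorem re_star_dotProduct_curOpTT'_mulVec (t' : ℝ) (φ : Fock (Orb (FermionTorus 2 L))) :
    (star φ ⬝ᵥ (curOpTT' L t' *ᵥ φ)).re =
      2 * ((∑ x : Site 2 L, ∑ σ : Fin 2,
          (star φ ⬝ᵥ ((creation (orb (FermionTorus.ofTorusSite (Site.shift x 0)) σ) *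
            annihilation (orb (FermionTorus.ofTorusSite x) σ)) *ᵥ φ)).im) +
        t' * ∑ s : Fin 2, ∑ x : Site 2 L, ∑ σ : Fin 2,
          (star φ ⬝ᵥ ((creation (orb (FermionTorus.ofTorusSite (x + torusDiagJump L s)) σ) *
            annihilation (orb (FermionTorus.ofTorusSite x) σ)) *ᵥ φ)).im) := by
  have hx : (star φ ⬝ᵥ ((∑ x : Site 2 L, ∑ σ : Fin 2,
      ((-Complex.I) • (creation (orb (FermionTorus.ofTorusSite (Site.shift x 0)) σ) *
          annihilation (orb (FermionTorus.ofTorusSite x) σ)) +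
        Complex.I • (creation (orb (FermionTorus.ofTorusSite x) σ) *
          annihilation (orb (FermionTorus.ofTorusSite (Site.shift x 0)) σ)))) *ᵥ φ)).re =
      2 * ∑ x : Site 2 L, ∑ σ : Fin 2,
          (star φ ⬝ᵥ ((creation (orb (FermionTorus.ofTorusSite (Site.shift x 0)) σ) *
            annihilation (orb (FermionTorus.ofTorusSite x) σ)) *ᵥ φ)).im := by
    simp only [Matrix.sum_mulVec, dotProduct_sum, Complex.re_sum, add_mulVec, smul_mulVec,
      dotProduct_add, dotProduct_smul, smul_eq_mul, Complex.add_re, Finset.mul_sum]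
    refine Finset.sum_congr rfl fun x _ => Finset.sum_congr rfl fun σ _ => ?_
    rw [star_dotProduct_creation_mul_annihilation_mulVec_swap
        (orb (FermionTorus.ofTorusSite (Site.shift x 0)) σ) (orb (FermionTorus.ofTorusSite x) σ)]
    simp only [Complex.mul_re, Complex.neg_re, Complex.neg_im, Complex.I_re, Complex.I_im,
      Complex.conj_re, Complex.conj_im]
    ring
  unfold curOpTT'
  rw [add_mulVec, dotProduct_add, Complex.add_re, hx, smul_mulVec, dotProduct_smul, smul_eq_mul,
    Complex.re_ofReal_mul, re_star_dotProduct_diagPeierlsHopping_const_mulVec, Complex.neg_re,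
    Complex.neg_im, Complex.I_re, Complex.I_im]
  ring

/-- **The uniform twist in a fixed vector, operator form** (`L ≥ 3`):
`Re⟨χ, H_θ χ⟩ = Re⟨χ, H χ⟩ + (1 − cos(θ/L)) Re⟨χ, K χ⟩ + sin(θ/L) Re⟨χ, J χ⟩` with `K = kinOpTT'`,
`J = curOpTT'`. [cite: Watanabe2019, §2.2.3 and §4.1] -/
theorem re_uniformTwistTT'_eq_kin_cur (hL : 3 ≤ L) (t' U θ : ℝ)
    (χ : Fock (Orb (FermionTorus 2 L))) :
    (star χ ⬝ᵥ (uniformTwistTT' L t' U θ *ᵥ χ)).re =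
      (star χ ⬝ᵥ (hubbardTorusTT' L 1 t' U *ᵥ χ)).re +
        (1 - Real.cos (θ / L)) * (star χ ⬝ᵥ (kinOpTT' L t' *ᵥ χ)).re +
        Real.sin (θ / L) * (star χ ⬝ᵥ (curOpTT' L t' *ᵥ χ)).re := by
  rw [re_star_dotProduct_uniformTwistTT'_mulVec hL, re_star_dotProduct_kinOpTT'_mulVec,
    re_star_dotProduct_curOpTT'_mulVec]
  ring

/-- **The flux envelope prices every sector vector** (`L ≥ 3`): `E^{tt'}(θ) ‖χ‖² ≤ Re⟨χ, H_θ χ⟩`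
for every `χ` of the sector `(N_L, 0)` (uniform gauge + sector Rayleigh bound).
[cite: Watanabe2019, §2.2.3 and §4.1] -/
theorem fluxEnergyTT'_mul_normSq_le (hL : 3 ≤ L) (t' U δ θ : ℝ)
    {χ : Fock (Orb (FermionTorus 2 L))} (hχ : χ ∈ szSector (2 * ⌊(1 - δ) * (L : ℝ) ^ 2 / 2⌋₊) 0) :
    fluxEnergyTT' L t' U δ θ * (star χ ⬝ᵥ χ).re ≤
      (star χ ⬝ᵥ (uniformTwistTT' L t' U θ *ᵥ χ)).re := by
  rw [fluxEnergyTT'_eq_minEnergyOn_uniform hL]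
  exact minEnergyOn_mul_re_le (isHermitian_uniformTwistTT' t' U θ) _ hχ

/-! ### The one-parameter trial state `ψ + m Jψ` at flux `θ` -/

/-- **The trial inequality**: for a unit zero-flux sector ground state `ψ` (energy `E₀ = E(0)`),
`φ = Jψ` and real `m`, pricing `χ = ψ + m φ ∈` sector at flux `θ` gives
`E(θ)(1 + 2m Re⟨φ,ψ⟩ + m² ‖φ‖²) ≤ E₀(1 + 2m Re⟨φ,ψ⟩ + m² ‖φ‖²) + m² (Re⟨φ,Hφ⟩ − E₀‖φ‖²)
  + (1 − cos(θ/L))(Re⟨ψ,Kψ⟩ + 2m Re⟨φ,Kψ⟩ + m² Re⟨φ,Kφ⟩)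
  + sin(θ/L)(Re⟨ψ,Jψ⟩ + 2m ‖φ‖² + m² Re⟨φ,Jφ⟩)`
(`Re⟨φ, Jψ⟩ = ‖φ‖²`, `Re⟨φ, Hψ⟩ = E₀ Re⟨φ, ψ⟩`). [cite: HazraVermaRanderia2019, eqs. (2)–(4)] -/
theorem fluxEnergyTT'_trial_le (hL : 3 ≤ L) (t' U δ θ m : ℝ) {ψ : Fock (Orb (FermionTorus 2 L))}
    (hgs : IsGroundStateInSector (hubbardTorusTT' L 1 t' U) (2 * ⌊(1 - δ) * (L : ℝ) ^ 2 / 2⌋₊) 0 ψ)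
    (h1 : star ψ ⬝ᵥ ψ = 1) :
    fluxEnergyTT' L t' U δ θ *
        (1 + 2 * m * (star (curOpTT' L t' *ᵥ ψ) ⬝ᵥ ψ).re +
          m ^ 2 * (star (curOpTT' L t' *ᵥ ψ) ⬝ᵥ (curOpTT' L t' *ᵥ ψ)).re) ≤
      fluxEnergyTT' L t' U δ 0 *
          (1 + 2 * m * (star (curOpTT' L t' *ᵥ ψ) ⬝ᵥ ψ).re +
            m ^ 2 * (star (curOpTT' L t' *ᵥ ψ) ⬝ᵥ (curOpTT' L t' *ᵥ ψ)).re) +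
        m ^ 2 * ((star (curOpTT' L t' *ᵥ ψ) ⬝ᵥ
            (hubbardTorusTT' L 1 t' U *ᵥ (curOpTT' L t' *ᵥ ψ))).re -
          fluxEnergyTT' L t' U δ 0 *
            (star (curOpTT' L t' *ᵥ ψ) ⬝ᵥ (curOpTT' L t' *ᵥ ψ)).re) +
        (1 - Real.cos (θ / L)) *
          ((star ψ ⬝ᵥ (kinOpTT' L t' *ᵥ ψ)).re +
            2 * m * (star (curOpTT' L t' *ᵥ ψ) ⬝ᵥ (kinOpTT' L t' *ᵥ ψ)).re +
            m ^ 2 * (star (curOpTT' L t' *ᵥ ψ) ⬝ᵥ (kinOpTT' L t' *ᵥ (curOpTT' L t' *ᵥ ψ))).re) +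
        Real.sin (θ / L) *
          ((star ψ ⬝ᵥ (curOpTT' L t' *ᵥ ψ)).re +
            2 * m * (star (curOpTT' L t' *ᵥ ψ) ⬝ᵥ (curOpTT' L t' *ᵥ ψ)).re +
            m ^ 2 * (star (curOpTT' L t' *ᵥ ψ) ⬝ᵥ (curOpTT' L t' *ᵥ (curOpTT' L t' *ᵥ ψ))).re) := by
  have hE : (star ψ ⬝ᵥ (hubbardTorusTT' L 1 t' U *ᵥ ψ)).re = fluxEnergyTT' L t' U δ 0 :=
    re_star_dotProduct_mulVec_eq_fluxEnergyTT'_zero t' U δ hgs h1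
  obtain ⟨hψS, -, hHψ⟩ := hgs
  have hE0 : (hubbardTorusTT' L 1 t' U).minEnergyOn
      (szSector (2 * ⌊(1 - δ) * (L : ℝ) ^ 2 / 2⌋₊) 0) = fluxEnergyTT' L t' U δ 0 := by
    rw [fluxEnergyTT'_eq, hubbardTorusTT'Flux_zero]
  rw [hE0] at hHψ
  have hφH : (star (curOpTT' L t' *ᵥ ψ) ⬝ᵥ (hubbardTorusTT' L 1 t' U *ᵥ ψ)).re =
      fluxEnergyTT' L t' U δ 0 * (star (curOpTT' L t' *ᵥ ψ) ⬝ᵥ ψ).re := by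
    rw [hHψ, dotProduct_smul, smul_eq_mul, Complex.re_ofReal_mul]
  have h1re : (star ψ ⬝ᵥ ψ).re = 1 := by rw [h1, Complex.one_re]
  have hφS : curOpTT' L t' *ᵥ ψ ∈ szSector (2 * ⌊(1 - δ) * (L : ℝ) ^ 2 / 2⌋₊) 0 :=
    mulVec_mem_szSector_of_preservesSectors (preservesSectors_curOpTT' t') hψS
  have hχS : ψ + (m : ℂ) • (curOpTT' L t' *ᵥ ψ) ∈ szSector (2 * ⌊(1 - δ) * (L : ℝ) ^ 2 / 2⌋₊) 0 :=
    Submodule.add_mem _ hψS (Submodule.smul_mem _ _ hφS)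
  have hray := fluxEnergyTT'_mul_normSq_le hL t' U δ θ hχS
  rw [re_uniformTwistTT'_eq_kin_cur hL, re_normSq_add_smul,
    re_quadForm_add_smul (hubbardTorusTT'_isHermitian L 1 t' U),
    re_quadForm_add_smul (isHermitian_kinOpTT' t'), re_quadForm_add_smul (isHermitian_curOpTT' t'),
    h1re, hE, hφH] at hray
  linarith

/-- **The trial inequality as a node** (`@[conjecture] def`, PROVED by `trialInequalityTT'_holds`
from `fluxEnergyTT'_trial_le`): for `L ≥ 3`, every `t'`, `U`, `δ`, `θ`, `m`, every unit zero-flux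
`(N_L, 0)`-sector ground state `ψ` of `H = hubbardTorusTT' L 1 t' U`, with `φ = Jψ`,
`J = curOpTT' L t'`, `K = kinOpTT' L t'`, `E(θ) = fluxEnergyTT' L t' U δ θ`:
`E(θ)(1 + 2m Re⟨φ,ψ⟩ + m²‖φ‖²) ≤ E(0)(1 + 2m Re⟨φ,ψ⟩ + m²‖φ‖²) + m²(Re⟨φ,Hφ⟩ − E(0)‖φ‖²)
 + (1 − cos(θ/L))(Re⟨ψ,Kψ⟩ + 2m Re⟨φ,Kψ⟩ + m² Re⟨φ,Kφ⟩) + sin(θ/L)(Re⟨ψ,Jψ⟩ + 2m‖φ‖² + m² Re⟨φ,Jφ⟩)`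
— the input of the current-moment ceiling (part 2). -/
@[conjecture] def TrialInequalityTT' : Prop :=
  ∀ (L : ℕ) [NeZero L], 3 ≤ L → ∀ (t' U δ θ m : ℝ) (ψ : Fock (Orb (FermionTorus 2 L))),
    IsGroundStateInSector (hubbardTorusTT' L 1 t' U) (2 * ⌊(1 - δ) * (L : ℝ) ^ 2 / 2⌋₊) 0 ψ →
    star ψ ⬝ᵥ ψ = 1 →
    fluxEnergyTT' L t' U δ θ *
        (1 + 2 * m * (star (curOpTT' L t' *ᵥ ψ) ⬝ᵥ ψ).re +
          m ^ 2 * (star (curOpTT' L t' *ᵥ ψ) ⬝ᵥ (curOpTT' L t' *ᵥ ψ)).re) ≤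
      fluxEnergyTT' L t' U δ 0 *
          (1 + 2 * m * (star (curOpTT' L t' *ᵥ ψ) ⬝ᵥ ψ).re +
            m ^ 2 * (star (curOpTT' L t' *ᵥ ψ) ⬝ᵥ (curOpTT' L t' *ᵥ ψ)).re) +
        m ^ 2 * ((star (curOpTT' L t' *ᵥ ψ) ⬝ᵥ
            (hubbardTorusTT' L 1 t' U *ᵥ (curOpTT' L t' *ᵥ ψ))).re -
          fluxEnergyTT' L t' U δ 0 *
            (star (curOpTT' L t' *ᵥ ψ) ⬝ᵥ (curOpTT' L t' *ᵥ ψ)).re) +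
        (1 - Real.cos (θ / L)) *
          ((star ψ ⬝ᵥ (kinOpTT' L t' *ᵥ ψ)).re +
            2 * m * (star (curOpTT' L t' *ᵥ ψ) ⬝ᵥ (kinOpTT' L t' *ᵥ ψ)).re +
            m ^ 2 * (star (curOpTT' L t' *ᵥ ψ) ⬝ᵥ (kinOpTT' L t' *ᵥ (curOpTT' L t' *ᵥ ψ))).re) +
        Real.sin (θ / L) *
          ((star ψ ⬝ᵥ (curOpTT' L t' *ᵥ ψ)).re +
            2 * m * (star (curOpTT' L t' *ᵥ ψ) ⬝ᵥ (curOpTT' L t' *ᵥ ψ)).re +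
            m ^ 2 * (star (curOpTT' L t' *ᵥ ψ) ⬝ᵥ (curOpTT' L t' *ᵥ (curOpTT' L t' *ᵥ ψ))).re)

/-- **`TrialInequalityTT'` holds** (`fluxEnergyTT'_trial_le`). -/
theorem trialInequalityTT'_holds : TrialInequalityTT' :=
  fun _ _ hL t' U δ θ m _ hgs h1 => fluxEnergyTT'_trial_le hL t' U δ θ m hgs h1

end Summit.HubbardSuperconductivity.HubbardLadder.Bounds
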